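import Literature.Combinatorics.Optimization.DisjointnessPsdRank
import HarnessLib

/-!
# `B₄`, `B₅` for the complex psd rank: LWdW Lemma 17, Theorems 24, 29, Corollaries 26, 31,
# Theorem 43, Proposition 44, Example 33 as printed (Lee–Wei–de Wolf 2017, §§4.2–4.4, §5, §6.1) — all PROVED

Source: T. Lee, Z. Wei, R. de Wolf, *Some upper and lower bounds on PSD-rank*, Math. Program. 162
(2017) 495–521 = arXiv:1407.4308 [LeeWeiDeWolf2017]; held text `paper:arxiv-1407.4308`, p09 (Lemma
17), p10 (Def. 23 / Thm. 24), p13 (Thm. 43, Prop. 44). The tree's `PsdRankFidelityLowerBounds.lean`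
proves Lemma 17 and `B₄` (Theorem 24) "for the tree's real factorizations"
(`LeeWeiDeWolf2017_lemma17_real`, `LeeWeiDeWolf2017_thm24_real`); the source's PSD-rank has complex
Hermitian factors (p05), i.e. `HasComplexPsdFactorization`. This file proves the printed (complex)
statements.

Printed statements (verbatim). "**Lemma 17.** [...] a size-optimal PSD-factorization can be chosen such
that `Σ_i E_i = I` [...] `Tr(F_j) = 1`." "**Definition 23.** For nonnegative stochastic matrix `P`,
define `B₄(P) = Σ_i max_j P(i,j)`. **Theorem 24.** `rank_psd(P) ≥ B₄(P)`." "**Theorem 43.** If an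
`n`-by-`n` matrix `A` is an `ε`-approximation of the identity, then `rank_psd(A) ≥ n/(1 + ε(n−1))`."
"**Proposition 44.** Suppose `A(i,i) = 1` for all `i ∈ [n]` and `A(i,j) = ε` for `i ≠ j`, then
`rank_psd(A) = n` if and only if `ε < 1/(n−1)²`."

## Contents

* `exists_posSemidef_sum_eq_one_congr_complex` — the congruence normal form of a finite family of
  Hermitian psd matrices, COMPRESSED to the rank `m ≤ k` of their sum: `A_i = Rᴴ F_i R` with
  `Σ_i F_i = I_m` (`R : m × k`). Port of the tree's real `exists_posSemidef_sum_eq_one_congr`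
  (`PsdRankBasicProperties.lean`: compress to `(ker Σ A_i)ᗮ` by an orthonormal basis, write the
  compression of `Σ A_i` as `RᴴR` with `R` invertible, conjugate), without the padding back to size
  `k` (not needed for the inequalities).
* `LeeWeiDeWolf2017_lemma17_complex` — **Lemma 17** for complex factorizations (normal form at some
  size `m ≤ r`; the source takes `m = r` by size-minimality).
* `LeeWeiDeWolf2017_thm24_complex` — **Theorem 24**, `B₄ ≤ r` for every complex psd factorization of
  size `r` of a column-stochastic `P` (`max_j` as an arbitrary selection `c`; `Re Tr(E_iF_j) ≤
  Tr E_i · Tr F_j`).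
* `HasComplexPsdFactorization.colScale`, **Theorem 43** as printed (`LeeWeiDeWolf2017_thm43`:
  `n ≤ r (1 + ε(n−1))` for a complex psd factorization of size `r` of an `ε`-approximation of the
  identity) and **Proposition 44** as printed for `n ≥ 3` (`LeeWeiDeWolf2017_prop44`: complex psd
  rank of `A_ε` is `n` iff `ε < 1/(n−1)²`; the `⇒` half is `LeeWeiDeWolf2017_prop44_notFull` of
  `DisjointnessPsdRank.lean`; scope note there: `n = 2` needs `ε ≤ 1`).
* (appended) `LeeWeiDeWolf2017_thm29_complex` — **Theorem 29**, `B₅ ≤ r` for every complex psd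
  factorization (Lemma 17, `σ_i = Σ_k q_k F_k`, the measurement inequality
  `FidelityBound.re_trace_le_sq_sum_sqrt`, Hilbert–Schmidt Cauchy–Schwarz `norm_trace_mul_sq_le`).
* (appended) the rescaled variants: `HasComplexPsdFactorization.rowScale`, `lwdwRescale d P = (DP)_j`
  (column-normalised row rescaling), **Corollary 26** (`LeeWeiDeWolf2017_cor26_complex`, `B₄' ≤ r`)
  and **Corollary 31** (`LeeWeiDeWolf2017_cor31_complex`, `B₅' ≤ r`); **Example 33**
  (`LeeWeiDeWolf2017_ex33`: `rank_psd(A_{1/n}) ≥ (n+1)/2` for the `(n+1) × (n+1)` matrix).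
-/

noncomputable section

open Matrix Finset

open scoped MatrixOrder ComplexOrder

namespace Literature.Combinatorics.Optimization

/-! ### Plumbing: orthonormal-basis matrices over `ℂ`, a trace inequality -/

section ONB

variable {d m : ℕ} {K : Submodule ℂ (EuclideanSpace ℂ (Fin d))}

/-- The `d × m` matrix of an orthonormal basis of a subspace `K ⊆ ℂ^d`. [folklore] -/
private def onbC (b : OrthonormalBasis (Fin m) ℂ K) : Matrix (Fin d) (Fin m) ℂ :=
  Matrix.of fun s a => (b a : EuclideanSpace ℂ (Fin d)) s

/-- `QᴴQ = I`. [folklore] -/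
private theorem onbC_conjTranspose_mul_self (b : OrthonormalBasis (Fin m) ℂ K) :
    (onbC b)ᴴ * onbC b = 1 := by
  ext a c
  have h := orthonormal_iff_ite.mp b.orthonormal a c
  rw [Submodule.coe_inner] at h
  have h' : ∑ s, star ((b a : EuclideanSpace ℂ (Fin d)) s) * (b c : EuclideanSpace ℂ (Fin d)) s =
      if a = c then 1 else 0 := by
    simpa [PiLp.inner_apply, mul_comm] using h
  rw [Matrix.mul_apply, Matrix.one_apply, ← h']
  simp only [onbC, conjTranspose_apply, of_apply]

/-- `Q Qᴴ v = v` for `v ∈ K`. [folklore] -/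
private theorem onbC_proj_mulVec (b : OrthonormalBasis (Fin m) ℂ K)
    {v : EuclideanSpace ℂ (Fin d)} (hv : v ∈ K) :
    (onbC b * (onbC b)ᴴ) *ᵥ v.ofLp = v.ofLp := by
  classical
  funext s
  have h := b.sum_repr' ⟨v, hv⟩
  have h2 := congrArg (fun w : K => (w : EuclideanSpace ℂ (Fin d)) s) h
  simp only [Submodule.coe_sum, Submodule.coe_smul, Submodule.coe_inner] at h2
  have h3 : ∑ a, (inner ℂ (b a : EuclideanSpace ℂ (Fin d)) v) *
      (b a : EuclideanSpace ℂ (Fin d)) s = v s := by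
    simpa [WithLp.ofLp_sum, Finset.sum_apply, smul_eq_mul] using h2
  rw [← mulVec_mulVec]
  change _ = v s
  rw [← h3]
  simp only [mulVec, dotProduct, onbC, conjTranspose_apply, of_apply]
  refine sum_congr rfl fun a _ => ?_
  rw [mul_comm]
  congr 1
  simp [PiLp.inner_apply, mul_comm]

/-- `Q Qᴴ A = A` when the columns of `A` lie in `K`. [folklore] -/
private theorem onbC_proj_mul (b : OrthonormalBasis (Fin m) ℂ K) {A : Matrix (Fin d) (Fin d) ℂ}
    (hrange : ∀ w : Fin d → ℂ, WithLp.toLp 2 (A *ᵥ w) ∈ K) :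
    onbC b * (onbC b)ᴴ * A = A := by
  classical
  ext s t
  have h := congrFun (onbC_proj_mulVec b (hrange (Pi.single t 1))) s
  simp only [mulVec_mulVec] at h
  simpa [Matrix.mulVec_single_one] using h

/-- The columns of `Q` lie in `K`. [folklore] -/
private theorem onbC_mulVec_mem (b : OrthonormalBasis (Fin m) ℂ K) (v : Fin m → ℂ) :
    WithLp.toLp 2 (onbC b *ᵥ v) ∈ K := by
  classical
  have hrepr : WithLp.toLp 2 (onbC b *ᵥ v) = ∑ a, v a • (b a : EuclideanSpace ℂ (Fin d)) := by
    ext s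
    simp [onbC, mulVec, dotProduct, WithLp.ofLp_sum, Finset.sum_apply, mul_comm]
  rw [hrepr]
  exact Submodule.sum_mem _ fun a _ => Submodule.smul_mem _ _ (b a).2

end ONB

/-- For complex psd `A, B`: `Re Tr(AB) ≤ Tr A · Tr B`. [folklore] -/
private theorem re_trace_mul_le_mul_trace' {n : Type*} [Fintype n] [DecidableEq n]
    {A B : Matrix n n ℂ} (hA : A.PosSemidef) (hB : B.PosSemidef) :
    (A * B).trace.re ≤ A.trace.re * B.trace.re := by
  have hcs := Literature.MathematicalPhysics.QuantumLattice.norm_trace_mul_le_sqrt_mul_sqrt A B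
  rw [hA.1.eq, hB.1.eq] at hcs
  have hA0 : 0 ≤ A.trace.re := (Complex.nonneg_iff.1 hA.trace_nonneg).1
  have hB0 : 0 ≤ B.trace.re := (Complex.nonneg_iff.1 hB.trace_nonneg).1
  have h1 : √((A * A).trace.re) ≤ A.trace.re := by
    rw [← Real.sqrt_sq hA0]
    exact Real.sqrt_le_sqrt (Literature.LinearAlgebra.Matrix.re_trace_mul_self_le_sq_of_posSemidef hA)
  have h2 : √((B * B).trace.re) ≤ B.trace.re := by
    rw [← Real.sqrt_sq hB0]
    exact Real.sqrt_le_sqrt (Literature.LinearAlgebra.Matrix.re_trace_mul_self_le_sq_of_posSemidef hB)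
  calc (A * B).trace.re ≤ ‖(A * B).trace‖ := Complex.re_le_norm _
    _ ≤ √((A * A).trace.re) * √((B * B).trace.re) := hcs
    _ ≤ A.trace.re * B.trace.re := mul_le_mul h1 h2 (Real.sqrt_nonneg _) hA0

/-! ### Congruence normalisation of a complex psd family (compressed form) -/

/-- **Congruence normalisation, complex and compressed** (the step "`C' = Σ_i E'_i` [...] `V C' V† = I`,
`E_i = V E'_i V†`" of the printed proof of LWdW Lemma 17, with the size reduced to the rank of
`Σ_i A_i` instead of assumed full by minimality): for a nonempty finite family of Hermitian psd
`k × k` matrices `A_i` there are `m ≤ k`, psd `m × m` matrices `F_i` with `Σ_i F_i = I_m`, and one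
`m × k` matrix `R` with `A_i = Rᴴ F_i R` for all `i`. [cite: LeeWeiDeWolf2017, Lemma 17 proof (p09)] -/
theorem exists_posSemidef_sum_eq_one_congr_complex {ι : Type*} [Fintype ι] [Nonempty ι] {k : ℕ}
    (A : ι → Matrix (Fin k) (Fin k) ℂ) (hA : ∀ i, (A i).PosSemidef) :
    ∃ (m : ℕ), m ≤ k ∧ ∃ (R : Matrix (Fin m) (Fin k) ℂ) (F : ι → Matrix (Fin m) (Fin m) ℂ),
      (∀ i, (F i).PosSemidef) ∧ ∑ i, F i = 1 ∧ ∀ i, A i = Rᴴ * F i * R := by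
  classical
  have hAh : ∀ i, (A i)ᴴ = A i := fun i => (hA i).1.eq
  -- `S = Σ_i A_i` and its kernel
  set S : Matrix (Fin k) (Fin k) ℂ := ∑ i, A i with hSdef
  have hSpsd : S.PosSemidef := posSemidef_sum _ fun i _ => hA i
  have hSh : Sᴴ = S := hSpsd.1.eq
  have hkerA : ∀ (u : Fin k → ℂ), S *ᵥ u = 0 → ∀ i, A i *ᵥ u = 0 := by
    intro u hu i
    have hsum : ∑ i', star u ⬝ᵥ (A i' *ᵥ u) = 0 := by
      rw [← dotProduct_sum, ← Matrix.sum_mulVec, ← hSdef, hu, dotProduct_zero]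
    have hnn : ∀ i', 0 ≤ star u ⬝ᵥ (A i' *ᵥ u) := fun i' => (hA i').dotProduct_mulVec_nonneg u
    have h0 : star u ⬝ᵥ (A i *ᵥ u) = 0 :=
      le_antisymm (by rw [← hsum]; exact single_le_sum (fun i' _ => hnn i') (mem_univ i)) (hnn i)
    exact (hA i).dotProduct_mulVec_zero_iff u |>.mp h0
  let kerS : Submodule ℂ (EuclideanSpace ℂ (Fin k)) :=
    { carrier := {v | S *ᵥ v.ofLp = 0}
      add_mem' := fun {u v} hu hv => by
        simp only [Set.mem_setOf_eq] at hu hv ⊢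
        rw [WithLp.ofLp_add, mulVec_add, hu, hv, add_zero]
      zero_mem' := by simp
      smul_mem' := fun c v hv => by
        simp only [Set.mem_setOf_eq] at hv ⊢
        rw [WithLp.ofLp_smul, mulVec_smul, hv, smul_zero] }
  let G : Submodule ℂ (EuclideanSpace ℂ (Fin k)) := kerSᗮ
  -- the `A_i` have range in `G`
  have hAG : ∀ i (w : Fin k → ℂ), WithLp.toLp 2 (A i *ᵥ w) ∈ G := fun i w => by
    rw [Submodule.mem_orthogonal]
    intro u hu
    have hu' : A i *ᵥ u.ofLp = 0 := hkerA _ hu i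
    have hinner : inner ℂ u (WithLp.toLp 2 (A i *ᵥ w)) = star u.ofLp ⬝ᵥ (A i *ᵥ w) := by
      simp [PiLp.inner_apply, dotProduct, mul_comm]
    rw [hinner, dotProduct_mulVec, ← hAh i, ← star_mulVec, hu', star_zero, zero_dotProduct]
  -- compression to `G`
  let bG := stdOrthonormalBasis ℂ G
  set m := Module.finrank ℂ G with hmdef
  have hmk : m ≤ k := by
    have h := Submodule.finrank_le G
    rwa [finrank_euclideanSpace, Fintype.card_fin] at h
  set Qm : Matrix (Fin k) (Fin m) ℂ := onbC bG with hQm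
  have hQtQ : Qmᴴ * Qm = 1 := onbC_conjTranspose_mul_self bG
  have hQmem : ∀ v : Fin m → ℂ, WithLp.toLp 2 (Qm *ᵥ v) ∈ G := onbC_mulVec_mem bG
  have hQQA : ∀ i, Qm * Qmᴴ * A i = A i := fun i => onbC_proj_mul bG (hAG i)
  have hAQQ : ∀ i, A i * (Qm * Qmᴴ) = A i := fun i => by
    have h := congrArg conjTranspose (hQQA i)
    rw [conjTranspose_mul, conjTranspose_mul, conjTranspose_conjTranspose, hAh] at h
    exact h
  let A' : ι → Matrix (Fin m) (Fin m) ℂ := fun i => Qmᴴ * A i * Qm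
  have hA' : ∀ i, (A' i).PosSemidef := fun i => (hA i).conjTranspose_mul_mul_same Qm
  have hAA' : ∀ i, A i = Qm * A' i * Qmᴴ := fun i => by
    calc A i = Qm * Qmᴴ * A i * (Qm * Qmᴴ) := by rw [hQQA, hAQQ]
      _ = Qm * (Qmᴴ * A i * Qm) * Qmᴴ := by simp only [Matrix.mul_assoc]
  -- `S' = Qᴴ S Q = Σ_i A'_i` is positive definite
  set S' : Matrix (Fin m) (Fin m) ℂ := ∑ i, A' i with hS'def
  have hS'eq : S' = Qmᴴ * S * Qm := by
    rw [hS'def, hSdef, Matrix.mul_sum, Matrix.sum_mul]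
  have hS'psd : S'.PosSemidef := posSemidef_sum _ fun i _ => hA' i
  have hS'pd : S'.PosDef := by
    refine PosDef.of_dotProduct_mulVec_pos hS'psd.1 fun x hx => lt_of_le_of_ne
      (hS'psd.dotProduct_mulVec_nonneg x) ?_
    intro h0
    have h1 : star (Qm *ᵥ x) ⬝ᵥ (S *ᵥ (Qm *ᵥ x)) = 0 := by
      have hq : star (Qm *ᵥ x) ⬝ᵥ (S *ᵥ (Qm *ᵥ x)) = star x ⬝ᵥ ((Qmᴴ * S * Qm) *ᵥ x) := by
        rw [← mulVec_mulVec, ← mulVec_mulVec, dotProduct_mulVec (star x) Qmᴴ, star_mulVec]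
      rw [hq, ← hS'eq, ← h0]
    have h2 : S *ᵥ (Qm *ᵥ x) = 0 := (hSpsd.dotProduct_mulVec_zero_iff _).mp h1
    have hmemK : WithLp.toLp 2 (Qm *ᵥ x) ∈ kerS := by
      change S *ᵥ (WithLp.toLp 2 (Qm *ᵥ x)).ofLp = 0
      simpa using h2
    have hmemG : WithLp.toLp 2 (Qm *ᵥ x) ∈ G := hQmem x
    have hzero : WithLp.toLp 2 (Qm *ᵥ x) = 0 := by
      have h := (Submodule.mem_orthogonal kerS _).mp hmemG _ hmemK
      exact inner_self_eq_zero.mp h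
    have hQx : Qm *ᵥ x = 0 := by
      have h := congrArg WithLp.ofLp hzero
      simpa using h
    apply hx
    calc x = (Qmᴴ * Qm) *ᵥ x := by rw [hQtQ, one_mulVec]
      _ = 0 := by rw [← mulVec_mulVec, hQx, mulVec_zero]
  -- `S' = Rᴴ R` with `R` invertible; conjugate by `R⁻¹`
  obtain ⟨Rm, hRm⟩ := CStarAlgebra.nonneg_iff_eq_star_mul_self.mp hS'psd.nonneg
  rw [star_eq_conjTranspose] at hRm
  have hRdet : IsUnit Rm.det := by
    have hd : IsUnit S'.det := (Matrix.isUnit_iff_isUnit_det _).mp hS'pd.isUnit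
    rw [hRm, det_mul, det_conjTranspose] at hd
    exact isUnit_of_mul_isUnit_right hd
  have hRRinv : Rm * Rm⁻¹ = 1 := Matrix.mul_nonsing_inv Rm hRdet
  have hRinvR : Rm⁻¹ * Rm = 1 := Matrix.nonsing_inv_mul Rm hRdet
  let A'' : ι → Matrix (Fin m) (Fin m) ℂ := fun i => (Rm⁻¹)ᴴ * A' i * Rm⁻¹
  have hA'' : ∀ i, (A'' i).PosSemidef := fun i => (hA' i).conjTranspose_mul_mul_same Rm⁻¹
  have hsumA'' : ∑ i, A'' i = 1 := by
    have h : ∑ i, A'' i = (Rm⁻¹)ᴴ * S' * Rm⁻¹ := by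
      rw [hS'def, Matrix.mul_sum, Matrix.sum_mul]
    rw [h, hRm]
    calc (Rm⁻¹)ᴴ * (Rmᴴ * Rm) * Rm⁻¹ = (Rm * Rm⁻¹)ᴴ * (Rm * Rm⁻¹) := by
          rw [conjTranspose_mul]; simp only [Matrix.mul_assoc]
      _ = 1 := by rw [hRRinv, conjTranspose_one, Matrix.one_mul]
  have hA'A'' : ∀ i, A' i = Rmᴴ * A'' i * Rm := fun i => by
    calc A' i = (Rm⁻¹ * Rm)ᴴ * A' i * (Rm⁻¹ * Rm) := by
          rw [hRinvR, conjTranspose_one, Matrix.one_mul, Matrix.mul_one]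
      _ = Rmᴴ * ((Rm⁻¹)ᴴ * A' i * Rm⁻¹) * Rm := by rw [conjTranspose_mul]; simp only [Matrix.mul_assoc]
  refine ⟨m, hmk, Rm * Qmᴴ, A'', hA'', hsumA'', fun i => ?_⟩
  rw [hAA' i, hA'A'' i, conjTranspose_mul, conjTranspose_conjTranspose]
  simp only [Matrix.mul_assoc]

/-! ### Lemma 17 and Theorem 24 (`B₄`) for complex psd factorizations -/

/-- **LWdW Lemma 17 for complex factorizations** (p09, verbatim: "a size-optimal PSD-factorization can
be chosen such that `Σ_i E_i = I` [...] and `Tr(F_j) = 1`"): a complex psd factorization of size `r`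
of a column-stochastic `P` yields one of some size `m ≤ r` with `Σ_i E_i = I_m` and `Tr F_j = 1`
(`E_i` from the congruence normal form of the row factors, `F_j = R B_j Rᴴ`; the printed proof takes
`m = r` using size-minimality). [cite: LeeWeiDeWolf2017, Lemma 17 (p09)] -/
theorem LeeWeiDeWolf2017_lemma17_complex {p q r : ℕ} (hp : 0 < p) {P : Fin p → Fin q → ℝ}
    (hPr : HasComplexPsdFactorization P r) (hcol : ∀ j, ∑ i, P i j = 1) :
    ∃ (m : ℕ), m ≤ r ∧ ∃ (E : Fin p → Matrix (Fin m) (Fin m) ℂ) (F : Fin q → Matrix (Fin m) (Fin m) ℂ),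
      (∀ i, (E i).PosSemidef) ∧ (∀ j, (F j).PosSemidef) ∧ ∑ i, E i = 1 ∧ (∀ j, (F j).trace = 1) ∧
        ∀ i j, ((P i j : ℝ) : ℂ) = (E i * F j).trace := by
  haveI : Nonempty (Fin p) := ⟨⟨0, hp⟩⟩
  obtain ⟨A, B, hA, hB, hPAB⟩ := hPr
  obtain ⟨m, hmr, R, E, hE, hE1, hAE⟩ := exists_posSemidef_sum_eq_one_congr_complex A hA
  have hP : ∀ i j, ((P i j : ℝ) : ℂ) = (E i * (R * B j * Rᴴ)).trace := fun i j => by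
    rw [hPAB, hAE, show Rᴴ * E i * R * B j = Rᴴ * (E i * R * B j) by simp only [Matrix.mul_assoc],
      trace_mul_comm]
    simp only [Matrix.mul_assoc]
  refine ⟨m, hmr, E, fun j => R * B j * Rᴴ, hE, fun j => (hB j).mul_mul_conjTranspose_same R, hE1,
    fun j => ?_, hP⟩
  calc (R * B j * Rᴴ).trace = ((∑ i, E i) * (R * B j * Rᴴ)).trace := by rw [hE1, Matrix.one_mul]
    _ = ∑ i, ((P i j : ℝ) : ℂ) := by
        rw [Finset.sum_mul, trace_sum]; exact Finset.sum_congr rfl fun i _ => (hP i j).symm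
    _ = 1 := by rw [← Complex.ofReal_sum, hcol j, Complex.ofReal_one]

/-- **LWdW Theorem 24 (`B₄`) for complex factorizations** (p10, verbatim: "Definition 23. For
nonnegative stochastic matrix `P`, define `B₄(P) = Σ_i max_j P(i,j)`. Theorem 24. `rank_psd(P) ≥ B₄(P)`"),
with `max_j` as an arbitrary column selection `c(i)`: every COMPLEX psd factorization of a
column-stochastic `P` of size `r` has `Σ_i P(i, c(i)) ≤ r` (printed proof: normalise by Lemma 17,
`Tr ρ_j = 1 ⇒ ρ_j ⪯ I`, `Tr(E_i) ≥ Tr(E_iρ_j)`, `r ≥ m = Σ_i Tr E_i`). The tree's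
`LeeWeiDeWolf2017_thm24_real` is the special case of real factors. [cite: LeeWeiDeWolf2017, Thm. 24 (p10)] -/
theorem LeeWeiDeWolf2017_thm24_complex {p q r : ℕ} {P : Fin p → Fin q → ℝ}
    (hPr : HasComplexPsdFactorization P r) (hcol : ∀ j, ∑ i, P i j = 1) (c : Fin p → Fin q) :
    ∑ i, P i (c i) ≤ r := by
  rcases Nat.eq_zero_or_pos p with hp | hp
  · subst hp
    simp
  obtain ⟨m, hmr, E, F, hE, hF, hE1, hF1, hP⟩ := LeeWeiDeWolf2017_lemma17_complex hp hPr hcol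
  have hPi : ∀ i, P i (c i) ≤ (E i).trace.re := fun i => by
    have h1 : P i (c i) = (E i * F (c i)).trace.re := by rw [← hP, Complex.ofReal_re]
    rw [h1]
    have h2 := re_trace_mul_le_mul_trace' (hE i) (hF (c i))
    rwa [hF1, Complex.one_re, mul_one] at h2
  calc ∑ i, P i (c i) ≤ ∑ i, (E i).trace.re := Finset.sum_le_sum fun i _ => hPi i
    _ = (∑ i, E i).trace.re := by rw [trace_sum, Complex.re_sum]
    _ = m := by rw [hE1, trace_one, Fintype.card_fin]; simp
    _ ≤ r := by exact_mod_cast hmr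

/-! ### Theorem 43 and Proposition 44 for the complex psd rank (as printed) -/

/-- Column scaling of a complex psd factorization by nonnegative reals. [cite: LeeWeiDeWolf2017, Thm. 43 proof (p13, "normalize each column")] -/
theorem HasComplexPsdFactorization.colScale {ι κ : Type*} {M : ι → κ → ℝ} {r : ℕ}
    (h : HasComplexPsdFactorization M r) {d : κ → ℝ} (hd : ∀ j, 0 ≤ d j) :
    HasComplexPsdFactorization (fun i j => M i j * d j) r := by
  obtain ⟨A, B, hA, hB, hM⟩ := h
  refine ⟨A, fun j => (d j : ℂ) • B j, hA, fun j => (hB j).smul (Complex.zero_le_real.mpr (hd j)),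
    fun i j => ?_⟩
  rw [Matrix.mul_smul, trace_smul, ← hM, smul_eq_mul, Complex.ofReal_mul, mul_comm]

/-- **LWdW Theorem 43** (p13, verbatim: "If an `n`-by-`n` matrix `A` is an `ε`-approximation of the
identity, then `rank_psd(A) ≥ n/(1 + ε(n−1))`"), for the complex psd rank as printed: a complex psd
factorization of size `r` has `n ≤ r(1 + ε(n−1))` (normalise the columns, then `B₄`,
`LeeWeiDeWolf2017_thm24_complex`). [cite: LeeWeiDeWolf2017, Thm. 43 (p13)] -/
theorem LeeWeiDeWolf2017_thm43 {n r : ℕ} (hn : 1 ≤ n) {A : Fin n → Fin n → ℝ} {ε : ℝ} (hε : 0 ≤ ε)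
    (hdiag : ∀ i, A i i = 1) (hoff : ∀ i j, i ≠ j → 0 ≤ A i j ∧ A i j ≤ ε)
    (hA : HasComplexPsdFactorization A r) : (n : ℝ) ≤ r * (1 + ε * (n - 1)) := by
  classical
  set s : Fin n → ℝ := fun j => ∑ i, A i j with hs
  have hnn : ∀ i j, 0 ≤ A i j := fun i j => by
    by_cases h : i = j
    · rw [h, hdiag]; norm_num
    · exact (hoff i j h).1
  have hs1 : ∀ j, 1 ≤ s j := fun j => by
    have := Finset.single_le_sum (f := fun i => A i j) (fun i _ => hnn i j) (Finset.mem_univ j)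
    simpa [hs, hdiag j] using this
  have hs2 : ∀ j, s j ≤ 1 + ε * (n - 1) := fun j => by
    have h : s j = A j j + ∑ i ∈ Finset.univ.erase j, A i j :=
      (Finset.add_sum_erase _ _ (Finset.mem_univ j)).symm
    have hb : ∑ i ∈ Finset.univ.erase j, A i j ≤ ∑ _i ∈ Finset.univ.erase j, ε :=
      Finset.sum_le_sum fun i hi => (hoff i j (Finset.ne_of_mem_erase hi)).2
    rw [Finset.sum_const, Finset.card_erase_of_mem (Finset.mem_univ j), Finset.card_univ,
      Fintype.card_fin, nsmul_eq_mul] at hb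
    rw [h, hdiag]
    have hcast : (((n - 1 : ℕ)) : ℝ) = (n : ℝ) - 1 := by rw [Nat.cast_sub hn, Nat.cast_one]
    rw [hcast] at hb
    linarith
  have hspos : ∀ j, 0 < s j := fun j => lt_of_lt_of_le one_pos (hs1 j)
  have hP : HasComplexPsdFactorization (fun i j => A i j * (s j)⁻¹) r :=
    hA.colScale fun j => inv_nonneg.mpr (hspos j).le
  have hcol : ∀ j, ∑ i, (fun i j => A i j * (s j)⁻¹) i j = 1 := fun j => by
    simp only [← Finset.sum_mul]
    exact mul_inv_cancel₀ (hspos j).ne'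
  have hB4 := LeeWeiDeWolf2017_thm24_complex hP hcol id
  simp only [id, hdiag, one_mul] at hB4
  have hK : 0 < 1 + ε * (n - 1) := by
    have : (1 : ℝ) ≤ n := by exact_mod_cast hn
    nlinarith
  have hterm : ∀ i, 1 / (1 + ε * (n - 1)) ≤ (s i)⁻¹ := fun i => by
    rw [one_div]; exact inv_anti₀ (hspos i) (hs2 i)
  have hsum : (n : ℝ) / (1 + ε * (n - 1)) ≤ ∑ i, (s i)⁻¹ := by
    calc (n : ℝ) / (1 + ε * (n - 1)) = ∑ _i : Fin n, 1 / (1 + ε * (n - 1)) := by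
          rw [Finset.sum_const, Finset.card_univ, Fintype.card_fin, nsmul_eq_mul, mul_one_div]
      _ ≤ ∑ i, (s i)⁻¹ := Finset.sum_le_sum fun i _ => hterm i
  have h := hsum.trans hB4
  rwa [div_le_iff₀ hK] at h

/-- **LWdW Proposition 44** (p13, verbatim: "Suppose `A(i,i) = 1` for all `i ∈ [n]` and `A(i,j) = ε`
for `i ≠ j`, then `rank_psd(A) = n` if and only if `ε < 1/(n−1)²`"), complex psd rank, for `n ≥ 3`
and `ε ≥ 0`: every complex psd factorization of `A_ε` has size `≥ n` iff `ε < 1/(n−1)²`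
(`⇐` Theorem 43; `⇒` Proposition 44's Theorem-11 half `LeeWeiDeWolf2017_prop44_notFull`). Scope note as
there: for `n = 2` the printed equivalence needs `ε ≤ 1`. [cite: LeeWeiDeWolf2017, Prop. 44 (p13)] -/
theorem LeeWeiDeWolf2017_prop44 {n : ℕ} (hn : 3 ≤ n) {ε : ℝ} (hε0 : 0 ≤ ε) :
    (∀ r, HasComplexPsdFactorization (offDiagConst n ε) r → n ≤ r) ↔ ε < 1 / ((n : ℝ) - 1) ^ 2 := by
  have hn1 : (0 : ℝ) < (n : ℝ) - 1 := by
    have : (3 : ℝ) ≤ n := by exact_mod_cast hn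
    linarith
  constructor
  · intro h
    by_contra hge
    have hge' : 1 / ((n : ℝ) - 1) ^ 2 ≤ ε := not_lt.mp hge
    have := h (n - 1) (LeeWeiDeWolf2017_prop44_notFull hn hε0 hge')
    omega
  · intro hε r hr
    have h43 := LeeWeiDeWolf2017_thm43 (by omega) hε0 (A := offDiagConst n ε)
      (fun i => by simp [offDiagConst]) (fun i j hij => by simp [offDiagConst, hij, hε0]) hr
    have hε' : ε * ((n : ℝ) - 1) ^ 2 < 1 := by
      have := (lt_div_iff₀ (by positivity : (0 : ℝ) < ((n : ℝ) - 1) ^ 2)).mp hε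
      linarith
    by_contra hlt
    have hr' : (r : ℝ) ≤ (n : ℝ) - 1 := by
      have : r + 1 ≤ n := by omega
      have : ((r + 1 : ℕ) : ℝ) ≤ n := by exact_mod_cast this
      push_cast at this
      linarith
    have hK : 0 ≤ 1 + ε * ((n : ℝ) - 1) := by nlinarith
    have : (n : ℝ) ≤ ((n : ℝ) - 1) * (1 + ε * ((n : ℝ) - 1)) := h43.trans (by nlinarith)
    nlinarith

/-! ### Theorem 29 (`B₅`) for complex psd factorizations -/

/-- **LWdW Theorem 29 (`B₅`) for complex factorizations** (p10, verbatim: "Definition 28. For a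
nonnegative stochastic matrix `P`, define `B₅(P) = Σ_i max_{q^{(i)}} (Σ_k q^{(i)}_k P(i,k)) /
√(Σ_{s,t} q^{(i)}_s q^{(i)}_t F(P_s,P_t)²)` [...] Theorem 29. `rank_psd(P) ≥ B₅(P)`"), with the maxima
as arbitrary nonnegative weight vectors `q i` (the printed normalisation `Σ_k q_k = 1` is not used by
the argument): every COMPLEX psd factorization of size `r` of a
column-stochastic `P` has `Σ_i (Σ_k q_{ik} P(i,k)) / √(Σ_{s,t} q_{is} q_{it} F(P_s,P_t)²) ≤ r` (printed
proof: normalise by Lemma 17, `σ_i = Σ_k q_k ρ_k`, `Tr²(E_iσ_i) ≤ Tr(E_i²) Tr(σ_i²) ≤ Tr(E_i)² Σ q_s q_t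
F(P_s,P_t)²`, `Σ Tr E_i = m ≤ r`). The tree's `LeeWeiDeWolf2017_thm29_real` is the real-factor case.
[cite: LeeWeiDeWolf2017, Def. 28 and Thm. 29 (p10)] -/
theorem LeeWeiDeWolf2017_thm29_complex {p n r : ℕ} {P : Fin p → Fin n → ℝ}
    (hPr : HasComplexPsdFactorization P r) (hcol : ∀ j, ∑ i, P i j = 1) (q : Fin p → Fin n → ℝ)
    (hq : ∀ i k, 0 ≤ q i k) :
    ∑ i, (∑ k, q i k * P i k) /
      √(∑ s, ∑ t, q i s * q i t * classicalFidelity (fun k => P k s) (fun k => P k t) ^ 2) ≤ r := by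
  rcases Nat.eq_zero_or_pos p with hp | hp
  · subst hp
    simp
  obtain ⟨m, hmr, E, F, hE, hF, hE1, -, hP⟩ := LeeWeiDeWolf2017_lemma17_complex hp hPr hcol
  have hPre : ∀ i j, P i j = (E i * F j).trace.re := fun i j => by rw [← hP, Complex.ofReal_re]
  calc ∑ i, (∑ k, q i k * P i k) /
        √(∑ s, ∑ t, q i s * q i t * classicalFidelity (fun k => P k s) (fun k => P k t) ^ 2)
      ≤ ∑ i, (E i).trace.re := Finset.sum_le_sum fun i _ => ?_
    _ = (∑ i, E i).trace.re := by rw [trace_sum, Complex.re_sum]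
    _ = m := by rw [hE1, trace_one, Fintype.card_fin]; simp
    _ ≤ r := by exact_mod_cast hmr
  -- one row `i`: `σ = Σ_k q_k F_k`, `N = Re Tr(E_i σ)`, `D = Σ q_s q_t F(P_s,P_t)² ≥ Re Tr σ²`
  set σ : Matrix (Fin m) (Fin m) ℂ := ∑ k, ((q i k : ℝ) : ℂ) • F k with hσdef
  set D := ∑ s, ∑ t, q i s * q i t * classicalFidelity (fun k => P k s) (fun k => P k t) ^ 2
    with hDdef
  have hσ : σ.PosSemidef :=
    posSemidef_sum _ fun k _ => (hF k).smul (Complex.zero_le_real.mpr (hq i k))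
  have hσh : σᴴ = σ := hσ.1.eq
  have hEh : (E i)ᴴ = E i := (hE i).1.eq
  have hE0 : 0 ≤ (E i).trace.re := (Complex.nonneg_iff.1 (hE i).trace_nonneg).1
  have hN : ∑ k, q i k * P i k = (E i * σ).trace.re := by
    rw [hσdef, Finset.mul_sum, trace_sum, Complex.re_sum]
    refine Finset.sum_congr rfl fun k _ => ?_
    rw [Matrix.mul_smul, trace_smul, smul_eq_mul, Complex.re_ofReal_mul, hPre]
  have hN0 : 0 ≤ (E i * σ).trace.re :=
    Literature.LinearAlgebra.Matrix.re_trace_mul_nonneg_of_posSemidef (hE i) hσ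
  -- `Re Tr σ² ≤ D`
  have hσσ : (σ * σ).trace.re ≤ D := by
    have e : (σ * σ).trace.re = ∑ s, ∑ t, q i s * q i t * (F s * F t).trace.re := by
      rw [hσdef, Finset.sum_mul, trace_sum, Complex.re_sum]
      refine Finset.sum_congr rfl fun s _ => ?_
      rw [Finset.mul_sum, trace_sum, Complex.re_sum]
      refine Finset.sum_congr rfl fun t _ => ?_
      rw [Matrix.smul_mul, Matrix.mul_smul, smul_smul, trace_smul, smul_eq_mul, ← Complex.ofReal_mul,
        Complex.re_ofReal_mul]
    rw [e, hDdef]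
    refine Finset.sum_le_sum fun s _ => Finset.sum_le_sum fun t _ =>
      mul_le_mul_of_nonneg_left ?_ (mul_nonneg (hq i s) (hq i t))
    have key := FidelityBound.re_trace_le_sq_sum_sqrt E hE (hF s) (hF t)
    rw [hE1, Matrix.one_mul, Matrix.one_mul] at key
    simp_rw [← hPre] at key
    exact key
  have hσσ0 : 0 ≤ (σ * σ).trace.re := by
    have := Literature.MathematicalPhysics.QuantumLattice.trace_mul_conjTranspose_self_re_nonneg σ
    rwa [hσh] at this
  -- Cauchy–Schwarz and `Re Tr E² ≤ (Re Tr E)²`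
  have hcs : (E i * σ).trace.re ^ 2 ≤ ((E i).trace.re * √D) ^ 2 :=
    calc (E i * σ).trace.re ^ 2 ≤ ‖(E i * σ).trace‖ ^ 2 := by
          have := Complex.abs_re_le_norm ((E i * σ).trace)
          rw [← sq_abs]
          exact pow_le_pow_left₀ (abs_nonneg _) this 2
      _ ≤ (E i * (E i)ᴴ).trace.re * (σᴴ * σ).trace.re :=
          Literature.MathematicalPhysics.QuantumLattice.norm_trace_mul_sq_le _ _
      _ = (E i * E i).trace.re * (σ * σ).trace.re := by rw [hEh, hσh]
      _ ≤ (E i).trace.re ^ 2 * D :=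
          mul_le_mul (Literature.LinearAlgebra.Matrix.re_trace_mul_self_le_sq_of_posSemidef (hE i))
            hσσ hσσ0 (sq_nonneg _)
      _ = ((E i).trace.re * √D) ^ 2 := by rw [mul_pow, Real.sq_sqrt (hσσ0.trans hσσ)]
  have hle : (E i * σ).trace.re ≤ (E i).trace.re * √D :=
    (pow_le_pow_iff_left₀ hN0 (mul_nonneg hE0 (Real.sqrt_nonneg _)) two_ne_zero).mp hcs
  rw [hN]
  rcases (Real.sqrt_nonneg D).eq_or_lt with hD | hD
  · rw [← hD, div_zero]; exact hE0
  · rwa [div_le_iff₀ hD]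

/-! ### The rescaled variants `B₄'`, `B₅'` (Corollaries 26, 31) and Example 33 -/

/-- Row scaling of a complex psd factorization by nonnegative reals. [cite: LeeWeiDeWolf2017, Def. 25 (p10, "`DP`, `D` a diagonal nonnegative matrix")] -/
theorem HasComplexPsdFactorization.rowScale {ι κ : Type*} {M : ι → κ → ℝ} {r : ℕ}
    (h : HasComplexPsdFactorization M r) {d : ι → ℝ} (hd : ∀ i, 0 ≤ d i) :
    HasComplexPsdFactorization (fun i j => d i * M i j) r := by
  obtain ⟨A, B, hA, hB, hM⟩ := h
  refine ⟨fun i => (d i : ℂ) • A i, B, fun i => (hA i).smul (Complex.zero_le_real.mpr (hd i)), hB,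
    fun i j => ?_⟩
  rw [Matrix.smul_mul, trace_smul, ← hM, smul_eq_mul, Complex.ofReal_mul]

/-- The column-normalised row rescaling `(DP)_j` of Definitions 25 / 30: entry `(i,j)` is
`d_i P(i,j) / Σ_i' d_i' P(i',j)`. [cite: LeeWeiDeWolf2017, Def. 25 (p10)] -/
def lwdwRescale {p n : ℕ} (d : Fin p → ℝ) (P : Fin p → Fin n → ℝ) : Fin p → Fin n → ℝ :=
  fun i j => d i * P i j / ∑ i', d i' * P i' j

/-- `(DP)_j` is column-stochastic and keeps complex psd factorizations of size `r` (when every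
rescaled column has a positive sum). [cite: LeeWeiDeWolf2017, Def. 25 and Cor. 26 (p10)] -/
theorem hasComplexPsdFactorization_lwdwRescale {p n r : ℕ} {P : Fin p → Fin n → ℝ}
    (hPr : HasComplexPsdFactorization P r) {d : Fin p → ℝ} (hd : ∀ i, 0 ≤ d i)
    (hpos : ∀ j, 0 < ∑ i, d i * P i j) :
    HasComplexPsdFactorization (lwdwRescale d P) r ∧ ∀ j, ∑ i, lwdwRescale d P i j = 1 := by
  refine ⟨?_, fun j => ?_⟩
  · have h := (hPr.rowScale hd).colScale (d := fun j => (∑ i, d i * P i j)⁻¹)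
      fun j => inv_nonneg.mpr (hpos j).le
    have heq : lwdwRescale d P = fun i j => d i * P i j * (∑ i', d i' * P i' j)⁻¹ :=
      funext fun i => funext fun j => by rw [lwdwRescale, div_eq_mul_inv]
    rwa [heq]
  · simp only [lwdwRescale, div_eq_mul_inv, ← Finset.sum_mul]
    exact mul_inv_cancel₀ (hpos j).ne'

/-- **LWdW Corollary 26 (`B₄'`) for complex factorizations** (p10, verbatim: "Definition 25. For a
nonnegative `m × n` matrix `P`, define `B₄'(P) = max_D Σ_i max_j ((DP)_j)_i`, where `D` is a diagonal
nonnegative matrix, `(DP)_j` is the probability distribution obtained by normalizing the `j`th column of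
`DP` [...]. Corollary 26. `rank_psd(P) ≥ B₄'(P)`"): for every nonnegative row scaling `d` with positive
rescaled column sums and every column selection `c`, `Σ_i ((DP)_{c(i)})_i ≤ r`.
[cite: LeeWeiDeWolf2017, Def. 25 and Cor. 26 (p10)] -/
theorem LeeWeiDeWolf2017_cor26_complex {p n r : ℕ} {P : Fin p → Fin n → ℝ}
    (hPr : HasComplexPsdFactorization P r) {d : Fin p → ℝ} (hd : ∀ i, 0 ≤ d i)
    (hpos : ∀ j, 0 < ∑ i, d i * P i j) (c : Fin p → Fin n) :
    ∑ i, lwdwRescale d P i (c i) ≤ r := by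
  obtain ⟨h1, h2⟩ := hasComplexPsdFactorization_lwdwRescale hPr hd hpos
  exact LeeWeiDeWolf2017_thm24_complex h1 h2 c

/-- **LWdW Corollary 31 (`B₅'`) for complex factorizations** (p10, verbatim: "Definition 30. [...]
`B₅'(P) = max_D Σ_i max_{q^{(i)}} (Σ_k q^{(i)}_k ((DP)_k)_i) / √(Σ_{s,t} q^{(i)}_s q^{(i)}_t
F((DP)_s,(DP)_t)²)` [...]. Corollary 31. `rank_psd(P) ≥ B₅'(P)`"): Theorem 29 applied to `(DP)`.
[cite: LeeWeiDeWolf2017, Def. 30 and Cor. 31 (p10)] -/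
theorem LeeWeiDeWolf2017_cor31_complex {p n r : ℕ} {P : Fin p → Fin n → ℝ}
    (hPr : HasComplexPsdFactorization P r) {d : Fin p → ℝ} (hd : ∀ i, 0 ≤ d i)
    (hpos : ∀ j, 0 < ∑ i, d i * P i j) (q : Fin p → Fin n → ℝ) (hq : ∀ i k, 0 ≤ q i k) :
    ∑ i, (∑ k, q i k * lwdwRescale d P i k) /
      √(∑ s, ∑ t, q i s * q i t *
        classicalFidelity (fun k => lwdwRescale d P k s) (fun k => lwdwRescale d P k t) ^ 2) ≤ r := by
  obtain ⟨h1, h2⟩ := hasComplexPsdFactorization_lwdwRescale hPr hd hpos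
  exact LeeWeiDeWolf2017_thm29_complex h1 h2 q hq

/-- **LWdW Example 33** (p11: the `(n+1) × (n+1)` matrix with ones on the diagonal and `ε = 1/n`
elsewhere has "`B₄(A) = (n+1)/2`", so `rank_psd(A) ≥ (n+1)/2` — quadratically better than
`B₁(A) = √n`, `B₂(A) ≈ √n/2`): every complex psd factorization of `A_{1/n}` of size `r` has
`(n+1)/2 ≤ r` (Theorem 43 with `ε(n+1−1) = 1`). [cite: LeeWeiDeWolf2017, Ex. 33 (p11)] -/
theorem LeeWeiDeWolf2017_ex33 {n r : ℕ} (hn : 1 ≤ n)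
    (hr : HasComplexPsdFactorization (offDiagConst (n + 1) (1 / (n : ℝ))) r) :
    ((n : ℝ) + 1) / 2 ≤ r := by
  have hn' : (0 : ℝ) < n := by exact_mod_cast hn
  have h43 := LeeWeiDeWolf2017_thm43 (n := n + 1) (by omega) (ε := 1 / (n : ℝ)) (by positivity)
    (A := offDiagConst (n + 1) (1 / (n : ℝ))) (fun i => by simp [offDiagConst])
    (fun i j hij => by simp [offDiagConst, hij]) hr
  push_cast at h43
  rw [add_sub_cancel_right, one_div_mul_cancel hn'.ne'] at h43
  linarith

end Literature.Combinatorics.Optimization
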